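import Summits.CriticalPhenomena.CardyFormulaZ2.Theorems.CardyIKTransportIKMixedBoxCrossingTransportStubCylPlaneBand

/-!
# Stub `stub_cylPlane` (line `defect-closure-exploration`, crux `IKMixedBoxCrossing`, stmt-CriticalPhenomena-5911) —
# helper 4: GEOMETRY — a black path between the two arcs crosses one of the two antipodal bands

Support file (`--supports stmt-CriticalPhenomena-5911`) for the registered stub `stub_cylPlane : CylPlane`.

* §1 Along an edge of the triangulation `cylGraph` the row changes by `0` or `±1` (`cylGraph_adj_row`).
* §2 DISCRETE INTERMEDIATE VALUES on the cycle `ℤ/8n` (`ivt`): a walk whose row coordinate `ν` (counted from row `n`) moves by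
  `0, ±1` cyclically per step, from a vertex with `ν ∈ [4n, 6n)` to a vertex with `ν < 2n`, contains a sub-walk inside the band
  `ν ∈ [2n, 4n)` joining its two extreme rows or a sub-walk inside the band `ν ∈ [6n, 8n)` joining its two extreme rows
  (induction on the walk, with the invariant `ivt_inv`; `bandReach`, `twoBands`).
* §3 Applied to a black path of `arcsEvent (n-1) (8n) n` and followed by the rotations by `3n`, `7n` rows
  (`cylGraph_adj_shift`): `arcsEvent ⊆ rot 3n ⁻¹' Band0 ∪ rot 7n ⁻¹' Band0` (`arcsEvent_subset`), where `Band0 w L H` is "a black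
  path inside the rows `0 … H-1` from row `0` to row `H-1`".
-/

noncomputable section

namespace Summit.CriticalPhenomena.CardyFormulaZ2.Cruxes.IKMixedBoxCrossing.DefectClosureExploration

open scoped BigOperators Classical
open Finset

namespace CylPlane

variable {w L : ℕ}

/-! ## §1 Rows move by at most one -/

/-- Along an edge of the triangulation of the slab the row changes by `0` or `±1`. -/
theorem cylGraph_adj_row {flg : Fin w × ZMod L → Bool} {p q : Fin (w + 1) × ZMod L} (h : (cylGraph w L flg).Adj p q) :
    q.2 = p.2 ∨ q.2 = p.2 + 1 ∨ p.2 = q.2 + 1 := by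
  rw [cylGraph, SimpleGraph.fromRel_adj] at h
  obtain ⟨-, h | h⟩ := h
  · rcases h with ⟨-, h2⟩ | ⟨-, h2⟩ | ⟨j, -, -, h3, -⟩ | ⟨j, -, -, h3, -⟩
    exacts [Or.inr (Or.inl h2), Or.inl h2, Or.inr (Or.inl h3), Or.inr (Or.inr h3)]
  · rcases h with ⟨-, h2⟩ | ⟨-, h2⟩ | ⟨j, -, -, h3, -⟩ | ⟨j, -, -, h3, -⟩
    exacts [Or.inr (Or.inr h2), Or.inl h2.symm, Or.inr (Or.inr h3), Or.inr (Or.inl h3)]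

/-! ## §2 Discrete intermediate values on the cycle -/

section IVT

variable {V : Type*} (G : SimpleGraph V) (ν : V → ℕ)

/-- The pairs `(a, b)` of vertices of the band `lo ≤ ν < hi` joined by a walk of `G` inside it. -/
def bandReach (lo hi : ℕ) : Set (V × V) := {ab |
  ∃ (ha : lo ≤ ν ab.1 ∧ ν ab.1 < hi) (hb : lo ≤ ν ab.2 ∧ ν ab.2 < hi),
    (G.induce {z | lo ≤ ν z ∧ ν z < hi}).Reachable ⟨ab.1, ha⟩ ⟨ab.2, hb⟩}

variable {G ν}

/-- Reflexivity inside the band. -/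
theorem bandReach_refl {lo hi : ℕ} {a : V} (ha : lo ≤ ν a ∧ ν a < hi) : (a, a) ∈ bandReach G ν lo hi :=
  ⟨ha, ha, SimpleGraph.Reachable.refl _⟩

/-- Symmetry. -/
theorem bandReach_symm {lo hi : ℕ} {a b : V} (h : (a, b) ∈ bandReach G ν lo hi) : (b, a) ∈ bandReach G ν lo hi := by
  obtain ⟨ha, hb, hr⟩ := h; exact ⟨hb, ha, hr.symm⟩

/-- Prepending an edge of the band. -/
theorem bandReach_cons {lo hi : ℕ} {a a' b : V} (hadj : G.Adj a a') (ha : lo ≤ ν a ∧ ν a < hi)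
    (h : (a', b) ∈ bandReach G ν lo hi) : (a, b) ∈ bandReach G ν lo hi := by
  obtain ⟨ha', hb, hr⟩ := h
  have e : (G.induce {z | lo ≤ ν z ∧ ν z < hi}).Adj ⟨a, ha⟩ ⟨a', ha'⟩ := hadj
  exact ⟨ha, hb, e.reachable.trans hr⟩

variable (G ν) in
/-- The scales `n` at which one of the two band crossings occurs: a walk inside `ν ∈ [2n, 4n)` between its extreme rows, or
a walk inside `ν ∈ [6n, 8n)` between its extreme rows. -/
def twoBands : Set ℕ := {n |
  (∃ a b, ν a = 2 * n ∧ ν b = 4 * n - 1 ∧ (a, b) ∈ bandReach G ν (2 * n) (4 * n)) ∨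
    (∃ a b, ν a = 6 * n ∧ ν b = 8 * n - 1 ∧ (a, b) ∈ bandReach G ν (6 * n) (8 * n))}

/-- The inductive invariant of the intermediate value argument, for a walk ending at a vertex with `ν < 2n`. -/
theorem ivt_inv {n : ℕ} (hn : 1 ≤ n) (hν : ∀ z, ν z < 8 * n)
    (hstep : ∀ p q, G.Adj p q → ν q = ν p ∨ ν q = ν p + 1 ∨ (ν p + 1 = 8 * n ∧ ν q = 0) ∨ ν p = ν q + 1 ∨
      (ν q + 1 = 8 * n ∧ ν p = 0))
    {s u : V} (p : G.Walk s u) (hu : ν u < 2 * n) :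
    (4 * n ≤ ν s → ν s < 6 * n → n ∈ twoBands G ν) ∧
    (2 * n ≤ ν s → ν s < 4 * n → n ∈ twoBands G ν ∨ ∃ a, ν a = 2 * n ∧ (s, a) ∈ bandReach G ν (2 * n) (4 * n)) ∧
    (6 * n ≤ ν s → n ∈ twoBands G ν ∨ ∃ a, ν a = 8 * n - 1 ∧ (s, a) ∈ bandReach G ν (6 * n) (8 * n)) := by
  induction p with
  | nil => exact ⟨fun h1 _ => by omega, fun h1 _ => by omega, fun h1 => by omega⟩
  | @cons s s₁ u' hadj p' ih =>
    obtain ⟨ih1, ih2, ih3⟩ := ih hu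
    have hs₁ := hν s₁
    have hs := hν s
    refine ⟨fun h1 h2 => ?_, fun h1 h2 => ?_, fun h1 => ?_⟩
    · -- `s` in the target arc `[4n, 6n)`
      rcases hstep s s₁ hadj with e | e | ⟨e1, e2⟩ | e | ⟨e1, e2⟩
      · exact ih1 (by omega) (by omega)
      · by_cases h6 : ν s₁ < 6 * n
        · exact ih1 (by omega) h6
        · rcases ih3 (by omega) with hQ | ⟨a, ha, hr⟩
          · exact hQ
          · exact Or.inr ⟨s₁, a, by omega, ha, hr⟩
      · omega
      · by_cases h4 : 4 * n ≤ ν s₁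
        · exact ih1 h4 (by omega)
        · rcases ih2 (by omega) (by omega) with hQ | ⟨a, ha, hr⟩
          · exact hQ
          · exact Or.inl ⟨a, s₁, ha, by omega, bandReach_symm hr⟩
      · omega
    · -- `s` in the band `[2n, 4n)`
      rcases hstep s s₁ hadj with e | e | ⟨e1, e2⟩ | e | ⟨e1, e2⟩
      · rcases ih2 (by omega) (by omega) with hQ | ⟨a, ha, hr⟩
        · exact Or.inl hQ
        · exact Or.inr ⟨a, ha, bandReach_cons hadj ⟨h1, h2⟩ hr⟩
      · by_cases h4 : ν s₁ < 4 * n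
        · rcases ih2 (by omega) h4 with hQ | ⟨a, ha, hr⟩
          · exact Or.inl hQ
          · exact Or.inr ⟨a, ha, bandReach_cons hadj ⟨h1, h2⟩ hr⟩
        · exact Or.inl (ih1 (by omega) (by omega))
      · omega
      · by_cases h3 : 2 * n ≤ ν s₁
        · rcases ih2 h3 (by omega) with hQ | ⟨a, ha, hr⟩
          · exact Or.inl hQ
          · exact Or.inr ⟨a, ha, bandReach_cons hadj ⟨h1, h2⟩ hr⟩
        · exact Or.inr ⟨s, by omega, bandReach_refl ⟨h1, h2⟩⟩
      · omega
    · -- `s` in the band `[6n, 8n)`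
      rcases hstep s s₁ hadj with e | e | ⟨e1, e2⟩ | e | ⟨e1, e2⟩
      · rcases ih3 (by omega) with hQ | ⟨a, ha, hr⟩
        · exact Or.inl hQ
        · exact Or.inr ⟨a, ha, bandReach_cons hadj ⟨h1, hs⟩ hr⟩
      · rcases ih3 (by omega) with hQ | ⟨a, ha, hr⟩
        · exact Or.inl hQ
        · exact Or.inr ⟨a, ha, bandReach_cons hadj ⟨h1, hs⟩ hr⟩
      · exact Or.inr ⟨s, by omega, bandReach_refl ⟨h1, hs⟩⟩
      · by_cases h6 : 6 * n ≤ ν s₁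
        · rcases ih3 h6 with hQ | ⟨a, ha, hr⟩
          · exact Or.inl hQ
          · exact Or.inr ⟨a, ha, bandReach_cons hadj ⟨h1, hs⟩ hr⟩
        · exact Or.inl (ih1 (by omega) (by omega))
      · omega

/-- **Discrete intermediate values on the cycle**: a walk from the arc `ν ∈ [4n, 6n)` to the arc `ν < 2n` crosses one of the
two bands between them. -/
theorem ivt {n : ℕ} (hn : 1 ≤ n) (hν : ∀ z, ν z < 8 * n)
    (hstep : ∀ p q, G.Adj p q → ν q = ν p ∨ ν q = ν p + 1 ∨ (ν p + 1 = 8 * n ∧ ν q = 0) ∨ ν p = ν q + 1 ∨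
      (ν q + 1 = 8 * n ∧ ν p = 0))
    {s u : V} (p : G.Walk s u) (hu : ν u < 2 * n) (hs : 4 * n ≤ ν s ∧ ν s < 6 * n) : n ∈ twoBands G ν :=
  (ivt_inv hn hν hstep p hu).1 hs.1 hs.2

end IVT

/-! ## §3 The slab: row coordinates, rotations, the band event -/

/-- `(y + 1).val` on `ℤ/L`: `y.val + 1`, or `0` at the seam. -/
theorem val_add_one_cases [NeZero L] (y : ZMod L) :
    (y + 1).val = y.val + 1 ∨ (y.val + 1 = L ∧ (y + 1).val = 0) := by
  rcases Nat.lt_or_ge (y.val + 1) L with h | h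
  · exact Or.inl (val_add_one y h)
  · have hy := ZMod.val_lt y
    have hyL : y.val + 1 = L := by omega
    exact Or.inr ⟨hyL, by rw [add_one_eq_zero y hyL, ZMod.val_zero]⟩

/-- The BAND EVENT: a black path inside the rows `0 … H-1` of the slab from a cell of row `0` to a cell of row `H-1`. -/
def Band0 (w L H : ℕ) : Set (CylCfg w L) :=
  {y | ∃ a b : Fin (w + 1) × ZMod L, a.2.val = 0 ∧ b.2.val = H - 1 ∧
    ∃ (ha : y.1 a = true ∧ a.2.val < H) (hb : y.1 b = true ∧ b.2.val < H),
      ((cylGraph w L y.2).induce {z | y.1 z = true ∧ z.2.val < H}).Reachable ⟨a, ha⟩ ⟨b, hb⟩}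

/-- The generating relation of `cylGraph` is invariant under the rotation of the rows. -/
theorem rel_shift (flg : Fin w × ZMod L → Bool) (c : ZMod L) (a b : Fin (w + 1) × ZMod L)
    (hr : (b.1 = a.1 ∧ b.2 + c = a.2 + c + 1) ∨ (b.1.val = a.1.val + 1 ∧ b.2 + c = a.2 + c) ∨
      (∃ j : Fin w, a.1 = j.castSucc ∧ b.1 = j.succ ∧ b.2 + c = a.2 + c + 1 ∧ flg (j, a.2 + c) = false) ∨
      (∃ j : Fin w, a.1 = j.castSucc ∧ b.1 = j.succ ∧ a.2 + c = b.2 + c + 1 ∧ flg (j, b.2 + c) = true)) :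
    (b.1 = a.1 ∧ b.2 = a.2 + 1) ∨ (b.1.val = a.1.val + 1 ∧ b.2 = a.2) ∨
      (∃ j : Fin w, a.1 = j.castSucc ∧ b.1 = j.succ ∧ b.2 = a.2 + 1 ∧ (fun f : Fin w × ZMod L => flg (f.1, f.2 + c)) (j, a.2) = false) ∨
      (∃ j : Fin w, a.1 = j.castSucc ∧ b.1 = j.succ ∧ a.2 = b.2 + 1 ∧ (fun f : Fin w × ZMod L => flg (f.1, f.2 + c)) (j, b.2) = true) := by
  rcases hr with ⟨h1, h2⟩ | ⟨h1, h2⟩ | ⟨j, h1, h2, h3, h4⟩ | ⟨j, h1, h2, h3, h4⟩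
  · exact Or.inl ⟨h1, by linear_combination h2⟩
  · exact Or.inr (Or.inl ⟨h1, by linear_combination h2⟩)
  · exact Or.inr (Or.inr (Or.inl ⟨j, h1, h2, by linear_combination h3, h4⟩))
  · exact Or.inr (Or.inr (Or.inr ⟨j, h1, h2, by linear_combination h3, h4⟩))

/-- The rotation `z ↦ z - c` of the rows is a graph homomorphism from the triangulation of `x` to that of `rotCfg c x`. -/
theorem cylGraph_adj_shift (flg : Fin w × ZMod L → Bool) (c : ZMod L) {p q : Fin (w + 1) × ZMod L}
    (h : (cylGraph w L flg).Adj (p.1, p.2 + c) (q.1, q.2 + c)) :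
    (cylGraph w L (fun f => flg (f.1, f.2 + c))).Adj p q := by
  rw [cylGraph, SimpleGraph.fromRel_adj] at h ⊢
  obtain ⟨hne, hr⟩ := h
  refine ⟨fun hpq => hne (by rw [hpq]), hr.imp (rel_shift flg c p q) (rel_shift flg c q p)⟩

/-- ROTATION of a band crossing: a black path of `x` inside the rows `c … c+H-1` (row coordinate `ν z = (z.2 - c).val < H`)
from row `c` to row `c + H - 1` is a `Band0` crossing of `rotCfg c x`. -/
theorem band0_of_bandReach [NeZero L] (x : CylCfg w L) (c : ZMod L) (H : ℕ)
    {a b : {z : Fin (w + 1) × ZMod L // x.1 z = true}} (ha : (a.1.2 - c).val = 0) (hb : (b.1.2 - c).val = H - 1)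
    (hr : (a, b) ∈ bandReach ((cylGraph w L x.2).induce {z | x.1 z = true}) (fun z => (z.1.2 - c).val) 0 H) :
    rotCfg c x ∈ Band0 w L H := by
  obtain ⟨ha', hb', hreach⟩ := hr
  let φ : (((cylGraph w L x.2).induce {z | x.1 z = true}).induce
      {z | 0 ≤ (z.1.2 - c).val ∧ (z.1.2 - c).val < H}) →g
      ((cylGraph w L (rotCfg c x).2).induce {z | (rotCfg c x).1 z = true ∧ z.2.val < H}) :=
    { toFun := fun z => ⟨(z.1.1.1, z.1.1.2 - c), by
        refine ⟨?_, z.2.2⟩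
        show x.1 (z.1.1.1, z.1.1.2 - c + c) = true
        rw [sub_add_cancel]; exact z.1.2⟩
      map_rel' := fun {z z'} hzz' => by
        show (cylGraph w L (fun f => x.2 (f.1, f.2 + c))).Adj (z.1.1.1, z.1.1.2 - c) (z'.1.1.1, z'.1.1.2 - c)
        apply cylGraph_adj_shift x.2 c
        show (cylGraph w L x.2).Adj (z.1.1.1, z.1.1.2 - c + c) (z'.1.1.1, z'.1.1.2 - c + c)
        rw [sub_add_cancel, sub_add_cancel]
        exact hzz' }
  have hmem : ∀ z : {z : Fin (w + 1) × ZMod L // x.1 z = true}, (z.1.2 - c).val < H →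
      (rotCfg c x).1 (z.1.1, z.1.2 - c) = true ∧ (z.1.2 - c).val < H := fun z hz =>
    ⟨by show x.1 (z.1.1, z.1.2 - c + c) = true; rw [sub_add_cancel]; exact z.2, hz⟩
  exact ⟨(a.1.1, a.1.2 - c), (b.1.1, b.1.2 - c), ha, hb, hmem a ha'.2, hmem b hb'.2, hreach.map φ⟩

/-- The row coordinate counted from row `m`: along an edge it moves by `0, ±1` cyclically. -/
theorem step_rel [NeZero L] (x : CylCfg w L) (m : ZMod L)
    (p q : {z : Fin (w + 1) × ZMod L // x.1 z = true}) (h : ((cylGraph w L x.2).induce {z | x.1 z = true}).Adj p q) :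
    (q.1.2 - m).val = (p.1.2 - m).val ∨ (q.1.2 - m).val = (p.1.2 - m).val + 1 ∨
      ((p.1.2 - m).val + 1 = L ∧ (q.1.2 - m).val = 0) ∨ (p.1.2 - m).val = (q.1.2 - m).val + 1 ∨
      ((q.1.2 - m).val + 1 = L ∧ (p.1.2 - m).val = 0) := by
  have h' : (cylGraph w L x.2).Adj p.1 q.1 := h
  rcases cylGraph_adj_row h' with e | e | e
  · exact Or.inl (by rw [e])
  · have e' : q.1.2 - m = (p.1.2 - m) + 1 := by rw [e]; ring
    rw [e']
    rcases val_add_one_cases (p.1.2 - m) with h1 | ⟨h1, h2⟩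
    · exact Or.inr (Or.inl h1)
    · exact Or.inr (Or.inr (Or.inl ⟨h1, h2⟩))
  · have e' : p.1.2 - m = (q.1.2 - m) + 1 := by rw [e]; ring
    rw [e']
    rcases val_add_one_cases (q.1.2 - m) with h1 | ⟨h1, h2⟩
    · exact Or.inr (Or.inr (Or.inr (Or.inl h1)))
    · exact Or.inr (Or.inr (Or.inr (Or.inr ⟨h1, h2⟩)))

/-- `val` of a difference with a small natural number. -/
theorem val_sub_natCast [NeZero L] (y : ZMod L) (k : ℕ) (hk : k ≤ y.val) : (y - (k : ZMod L)).val = y.val - k := by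
  have hkL : k < L := lt_of_le_of_lt hk (ZMod.val_lt y)
  rw [ZMod.val_sub (by rw [ZMod.val_cast_of_lt hkL]; exact hk), ZMod.val_cast_of_lt hkL]

/-- **The arcs event is covered by the two rotated band events**: a black path between the arcs `[n, 3n)` and `[5n, 7n)` of
the slab of circumference `8n` crosses the band of rows `[3n, 5n)` or the band of rows `[7n, 8n) ∪ [0, n)`. -/
theorem arcsEvent_subset [NeZero L] {n : ℕ} (hn : 1 ≤ n) (hL : L = 8 * n) :
    arcsEvent w L n ⊆ rotCfg ((3 * n : ℕ) : ZMod L) ⁻¹' Band0 w L (2 * n) ∪ rotCfg ((7 * n : ℕ) : ZMod L) ⁻¹' Band0 w L (2 * n) := by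
  rintro x ⟨r₁, r₂, h1, h2, h3, h4, hu, hv, hreach⟩
  obtain ⟨p⟩ := hreach
  set G := (cylGraph w L x.2).induce {z | x.1 z = true} with hG
  set ν : {z : Fin (w + 1) × ZMod L // x.1 z = true} → ℕ := fun z => (z.1.2 - (n : ZMod L)).val with hν
  have hνlt : ∀ z, ν z < 8 * n := fun z => hL ▸ ZMod.val_lt _
  have hstep : ∀ p q, G.Adj p q → ν q = ν p ∨ ν q = ν p + 1 ∨ (ν p + 1 = 8 * n ∧ ν q = 0) ∨ ν p = ν q + 1 ∨
      (ν q + 1 = 8 * n ∧ ν p = 0) := fun p q hpq => hL ▸ step_rel x (n : ZMod L) p q hpq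
  have hνu : ν ⟨((0 : Fin (w + 1)), r₁), hu⟩ < 2 * n := by
    show (r₁ - (n : ZMod L)).val < 2 * n
    rw [val_sub_natCast r₁ n h1]; omega
  have hνs : 4 * n ≤ ν ⟨((0 : Fin (w + 1)), r₂), hv⟩ ∧ ν ⟨((0 : Fin (w + 1)), r₂), hv⟩ < 6 * n := by
    show 4 * n ≤ (r₂ - (n : ZMod L)).val ∧ (r₂ - (n : ZMod L)).val < 6 * n
    rw [val_sub_natCast r₂ n (by omega)]; omega
  have key : ∀ (z : {z : Fin (w + 1) × ZMod L // x.1 z = true}) (k : ℕ), k ≤ ν z →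
      (z.1.2 - ((n + k : ℕ) : ZMod L)).val = ν z - k := fun z k hk => by
    show (z.1.2 - ((n + k : ℕ) : ZMod L)).val = (z.1.2 - (n : ZMod L)).val - k
    rw [← val_sub_natCast _ k hk, Nat.cast_add, sub_sub]
  rcases ivt hn hνlt hstep p.reverse hνu hνs with ⟨a, b, ha, hb, hr⟩ | ⟨a, b, ha, hb, hr⟩
  · refine Or.inl (band0_of_bandReach x _ (2 * n) (a := a) (b := b) ?_ ?_ ?_)
    · rw [show 3 * n = n + 2 * n by ring, key a (2 * n) (by omega), ha]; omega
    · rw [show 3 * n = n + 2 * n by ring, key b (2 * n) (by omega), hb]; omega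
    · obtain ⟨ha', hb', hr'⟩ := hr
      have hmem : ∀ z : {z : Fin (w + 1) × ZMod L // x.1 z = true}, 2 * n ≤ ν z ∧ ν z < 4 * n →
          0 ≤ (z.1.2 - ((3 * n : ℕ) : ZMod L)).val ∧ (z.1.2 - ((3 * n : ℕ) : ZMod L)).val < 2 * n := fun z hz => by
        rw [show 3 * n = n + 2 * n by ring, key z (2 * n) hz.1]; omega
      let ψ : (G.induce {z | 2 * n ≤ ν z ∧ ν z < 4 * n}) →g
          (G.induce {z | 0 ≤ (z.1.2 - ((3 * n : ℕ) : ZMod L)).val ∧ (z.1.2 - ((3 * n : ℕ) : ZMod L)).val < 2 * n}) :=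
        { toFun := fun z => ⟨z.1, hmem z.1 z.2⟩
          map_rel' := fun h => h }
      exact ⟨hmem a ha', hmem b hb', hr'.map ψ⟩
  · refine Or.inr (band0_of_bandReach x _ (2 * n) (a := a) (b := b) ?_ ?_ ?_)
    · rw [show 7 * n = n + 6 * n by ring, key a (6 * n) (by omega), ha]; omega
    · rw [show 7 * n = n + 6 * n by ring, key b (6 * n) (by omega), hb]; omega
    · obtain ⟨ha', hb', hr'⟩ := hr
      have hmem : ∀ z : {z : Fin (w + 1) × ZMod L // x.1 z = true}, 6 * n ≤ ν z ∧ ν z < 8 * n →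
          0 ≤ (z.1.2 - ((7 * n : ℕ) : ZMod L)).val ∧ (z.1.2 - ((7 * n : ℕ) : ZMod L)).val < 2 * n := fun z hz => by
        rw [show 7 * n = n + 6 * n by ring, key z (6 * n) hz.1]; omega
      let ψ : (G.induce {z | 6 * n ≤ ν z ∧ ν z < 8 * n}) →g
          (G.induce {z | 0 ≤ (z.1.2 - ((7 * n : ℕ) : ZMod L)).val ∧ (z.1.2 - ((7 * n : ℕ) : ZMod L)).val < 2 * n}) :=
        { toFun := fun z => ⟨z.1, hmem z.1 z.2⟩
          map_rel' := fun h => h }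
      exact ⟨hmem a ha', hmem b hb', hr'.map ψ⟩


end CylPlane

/-- **Registered helper `cylPlane_arcsEvent_subset`** (line `defect-closure-exploration`, stub `stub_cylPlane`, steps (i)–(ii)):
a black path between the two arcs of the slab of circumference `8n` crosses the band of rows `[3n, 5n)` or the band of rows
`[7n, 8n) ∪ [0, n)` — the arcs event is covered by the two rotated band events. -/
theorem cylPlane_arcsEvent_subset : ∀ {w L : ℕ} [NeZero L] {n : ℕ}, 1 ≤ n → L = 8 * n →
    arcsEvent w L n ⊆ CylPlane.rotCfg ((3 * n : ℕ) : ZMod L) ⁻¹' CylPlane.Band0 w L (2 * n) ∪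
      CylPlane.rotCfg ((7 * n : ℕ) : ZMod L) ⁻¹' CylPlane.Band0 w L (2 * n) :=
  fun hn hL => CylPlane.arcsEvent_subset hn hL

end Summit.CriticalPhenomena.CardyFormulaZ2.Cruxes.IKMixedBoxCrossing.DefectClosureExploration

end
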